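import Literature.IUT.HodgeArakelov.LabelClassesOfCuspsCor24iClosure

/-!
# [IUTchII] Cor 2.4 (i), input (B) at ONE finite level: the combinatorial core «γ′ stabilises the component □̃», PROVED carrier-free

S. Mochizuki, *Inter-universal Teichmüller theory II*, kurims manuscript (Dec. 2020), §2, Cor 2.4 (i), proof p. 70 l. −2 –
p. 71 l. 3: "by applying the equivalence of [IUTchI], Corollary 2.3, (vi) [cf. also [CombGC], Proposition 1.2, (ii)], to the
various finite index open subgroups of `Δ^±_v`, it follows that `γ' ∈ Δ̂^±_{v□}`" ([IUTchII] Cor 2.4 (i), kurims pp.70-71)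
[claim: Mochizuki2012, status: disputed] (D-0012 claim key; series DISPUTED; nothing printed is asserted).

PROOF-ONLY companion (no definitions; abc-iut cell, wave 5, seat abc-iut-w5-d132) of `LabelClassesOfCusps` (abc-iut-L6-t1,
node `IUTchII:Cor2.4(i)`) and of abc-iut-w5-d121's `LabelClassesOfCuspsCor24iClosure` (p414651), whose
`PlusMinusTower.h23vi_of_levelwise` reduces the binder `h23vi` (GAP-LEDGER G-w4d012-2) to the PER-LEVEL statement
`hlevel : ∀ i γ', γ' ∈ Δ^±_v → I^{γ'} ⊆ Π^±_{v□} → ∃ k ∈ Δ^±_{v□}, k⁻¹γ' ∈ U_i`.  Row B4 of w5-d121's staged sub-DAG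
SUBDAG-IUTchII-Cor-24i-B.md asks for the DERIVATION of that per-level statement from the level-`i` incidence data; this file
kernel-checks that derivation ONCE AND FOR ALL over abstract per-level data (so that the levels carrier B0–B3, when typed on the
L5 side, only has to INSTANTIATE five named inputs):

AT ONE LEVEL (`hlevel_of_levelData`), data = a type `V` ("vertices of the dual graph `Γ_i` of the level-`i` covering"), a map
`sm : Π̂^cor_v → V → V` (the action, only its restriction to `Δ^±_v` is constrained), a set `comp ⊆ V` ("the connected component
`□̃_i` of the inverse image of `□` met by the cusp of `I_t`"), a map `cuspVtx : Π̂^cor_v → V` ("the vertex met by the cusp of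
`I_t^{g}` at level `i`"); hypotheses = the printed per-level inputs:
* `cuspVtx_mul` — "the cusp of `I_t^{ab}` is `a ·` (the cusp of `I_t^{b}`)" (equivariance; definition of the translate);
* `base` — the cusp of `I_t` itself meets `□̃_i` ([IUTchI] Cor 2.3 (vi) at level `i` for `I_t ⊆ Δ_{v□}`; this DEFINES `□̃_i`);
* `inc` — [IUTchI] Cor 2.3 (vi) at level `i`, direction ⇒ (after the commensurator step Cor 2.3 (i)/(iv), rows B2/B3): for
  `g ∈ Δ^±_v`, `I_t^{g} ⊆ Π^±_{v□}` ⇒ the cusp of `I_t^{g}` meets `□̃_i`;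
* `blk` — "[CombGC], Proposition 1.2, (ii)"-type graph fact: `g · □̃_i` is again a component of the inverse image of `□`, and
  distinct components are DISJOINT, so if `g · □̃_i` meets `□̃_i` then `g · □̃_i ⊆ □̃_i` (components are blocks of the action);
* `stab` — the stabiliser of `□̃_i` in `Δ^±_v` is `Δ^±_{v□}` modulo the level (`Stab(□̃_i) ⊆ Δ^±_{v□} · U_i`: the decomposition
  group of `□̃_i` is the image of `Δ^±_{v□} = Δ_{X,ℍ}`, and `U_i` acts trivially on `Γ_i`).
CONCLUSION: the binder `hlevel` at level `i`.  ALL LEVELS (`h23vi_of_levelData`): with a family of such data indexed by levels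
`U_i` shrinking to `1`, the binder `h23vi` of `cor24_i_of_inputs` — by abc-iut-w5-d121's `h23vi_of_levelwise`.  PROVED (ten lines
of group action bookkeeping); every input is a HYPOTHESIS about the genuine tower of coverings; typed ≠ proved; no side is taken
on [IUTchIII] Cor 3.12.
-/

namespace Literature.IUT.HodgeArakelov

open Topology
open scoped Pointwise

universe u

namespace PlusMinusTower

variable {S : BadPlaceSetting.{u}} {P : TopGroup.{u}} {T : TemperedCoverings S P} (W : PlusMinusTower T)

/-- **IUTchII:Cor2.4(i)** (kurims p.71 l.1–3, ONE finite level) **The per-level target `hlevel` from the level-`i` incidence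
data.**  Print: the cusp `c` of `I_t` meets the component `□̃_i`; by Cor 2.3 (vi) at level `i` so does the cusp `γ'·c` of
`I_t^{γ'}` (hypothesis `inc`); hence `γ'·□̃_i` meets `□̃_i`, so — distinct components of the inverse image of `□` being disjoint
(`blk`) — `γ'·□̃_i = □̃_i`, i.e. `γ'` stabilises `□̃_i`, i.e. (`stab`) `γ' ∈ Δ^±_{v□}·U_i`.  PROVED over ABSTRACT level data
(`V`, `sm`, `comp`, `cuspVtx`); every hypothesis is a named per-level input (see the file header).
[claim: Mochizuki2012, status: disputed] -/
theorem hlevel_of_levelData (H : Subgroup P) (I : Subgroup W.Corhat) (U : Subgroup W.Corhat)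
    {V : Type*} (sm : W.Corhat → V → V) (comp : Set V) (cuspVtx : W.Corhat → V)
    (cuspVtx_mul : ∀ a b : W.Corhat, cuspVtx (a * b) = sm a (cuspVtx b))
    (base : cuspVtx 1 ∈ comp)
    (inc : ∀ g : W.Corhat, g ∈ W.piPM ⊓ W.aug.ker →
      I.map (MulAut.conj g).toMonoidHom ≤ W.pmBox H → cuspVtx g ∈ comp)
    (blk : ∀ g : W.Corhat, g ∈ W.piPM ⊓ W.aug.ker →
      (∃ v ∈ comp, sm g v ∈ comp) → ∀ v ∈ comp, sm g v ∈ comp)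
    (stab : ∀ g : W.Corhat, g ∈ W.piPM ⊓ W.aug.ker →
      (∀ v ∈ comp, sm g v ∈ comp) → ∃ k ∈ W.deltaPmBox H, k⁻¹ * g ∈ U) :
    ∀ γ' : W.Corhat, γ' ∈ W.piPM ⊓ W.aug.ker →
      I.map (MulAut.conj γ').toMonoidHom ≤ W.pmBox H → ∃ k ∈ W.deltaPmBox H, k⁻¹ * γ' ∈ U := by
  intro γ' hγ' hc
  -- the cusp of `I^{γ'}` meets `□̃` (Cor 2.3 (vi) at this level) and is the `γ'`-translate of the cusp of `I`
  have hmeet : sm γ' (cuspVtx 1) ∈ comp := by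
    rw [← cuspVtx_mul, mul_one]
    exact inc γ' hγ' hc
  -- hence `γ' · □̃` meets `□̃`, so `γ'` stabilises `□̃` (components are blocks), so `γ' ∈ Δ^±_{v□} · U`
  exact stab γ' hγ' (blk γ' hγ' ⟨cuspVtx 1, base, hmeet⟩)

/-- **IUTchII:Cor2.4(i)** (kurims p.70 l.−2 – p.71 l.3, ALL levels) **The binder `h23vi` of `cor24_i_of_inputs` from per-level
incidence data**: a family of levels `U_i ⊆ Π̂^cor_v` shrinking to `1` ("the various finite index open subgroups of `Δ^±_v`";
`hbasis`) and, at each level, the abstract data and the five printed inputs of `hlevel_of_levelData`.  PROVED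
(`hlevel_of_levelData` at each level + abc-iut-w5-d121's `h23vi_of_levelwise`).  Every input is a HYPOTHESIS about the genuine
tower of coverings (rows B0–B3 of the (B) sub-DAG); nothing is asserted. [claim: Mochizuki2012, status: disputed] -/
theorem h23vi_of_levelData (H : Subgroup P) (I : Subgroup W.Corhat) {ι : Sort*} (U : ι → Subgroup W.Corhat)
    (hbasis : ∀ O ∈ 𝓝 (1 : W.Corhat), ∃ i, (U i : Set W.Corhat) ⊆ O)
    (V : ι → Type*) (sm : ∀ i, W.Corhat → V i → V i) (comp : ∀ i, Set (V i)) (cuspVtx : ∀ i, W.Corhat → V i)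
    (cuspVtx_mul : ∀ i (a b : W.Corhat), cuspVtx i (a * b) = sm i a (cuspVtx i b))
    (base : ∀ i, cuspVtx i 1 ∈ comp i)
    (inc : ∀ i (g : W.Corhat), g ∈ W.piPM ⊓ W.aug.ker →
      I.map (MulAut.conj g).toMonoidHom ≤ W.pmBox H → cuspVtx i g ∈ comp i)
    (blk : ∀ i (g : W.Corhat), g ∈ W.piPM ⊓ W.aug.ker →
      (∃ v ∈ comp i, sm i g v ∈ comp i) → ∀ v ∈ comp i, sm i g v ∈ comp i)
    (stab : ∀ i (g : W.Corhat), g ∈ W.piPM ⊓ W.aug.ker →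
      (∀ v ∈ comp i, sm i g v ∈ comp i) → ∃ k ∈ W.deltaPmBox H, k⁻¹ * g ∈ U i) :
    ∀ γ' : W.Corhat, γ' ∈ W.piPM ⊓ W.aug.ker →
      I.map (MulAut.conj γ').toMonoidHom ≤ W.pmBox H → γ' ∈ closure (W.deltaPmBox H : Set W.Corhat) :=
  W.h23vi_of_levelwise H I U hbasis fun i =>
    W.hlevel_of_levelData H I (U i) (sm i) (comp i) (cuspVtx i) (cuspVtx_mul i) (base i) (inc i) (blk i) (stab i)

/-- **IUTchII:Cor2.4(i)** (kurims p.71) **Variant with a genuine action**: when `Δ̂^±_v`'s action on the level-`i` vertices is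
given as a `MulAction` of `Π̂^cor_v` (only its restriction matters) and "the cusp of `I_t^{g}`" is the `g`-translate of a base
vertex `c_i`, the equivariance input is automatic and `base`/`inc`/`blk`/`stab` are the four remaining per-level inputs.
PROVED. [claim: Mochizuki2012, status: disputed] -/
theorem h23vi_of_levelAction (H : Subgroup P) (I : Subgroup W.Corhat) {ι : Sort*} (U : ι → Subgroup W.Corhat)
    (hbasis : ∀ O ∈ 𝓝 (1 : W.Corhat), ∃ i, (U i : Set W.Corhat) ⊆ O)
    (V : ι → Type*) [∀ i, MulAction W.Corhat (V i)] (comp : ∀ i, Set (V i)) (c : ∀ i, V i)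
    (base : ∀ i, c i ∈ comp i)
    (inc : ∀ i (g : W.Corhat), g ∈ W.piPM ⊓ W.aug.ker →
      I.map (MulAut.conj g).toMonoidHom ≤ W.pmBox H → g • c i ∈ comp i)
    (blk : ∀ i (g : W.Corhat), g ∈ W.piPM ⊓ W.aug.ker →
      (∃ v ∈ comp i, g • v ∈ comp i) → ∀ v ∈ comp i, g • v ∈ comp i)
    (stab : ∀ i (g : W.Corhat), g ∈ W.piPM ⊓ W.aug.ker →
      (∀ v ∈ comp i, g • v ∈ comp i) → ∃ k ∈ W.deltaPmBox H, k⁻¹ * g ∈ U i) :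
    ∀ γ' : W.Corhat, γ' ∈ W.piPM ⊓ W.aug.ker →
      I.map (MulAut.conj γ').toMonoidHom ≤ W.pmBox H → γ' ∈ closure (W.deltaPmBox H : Set W.Corhat) :=
  W.h23vi_of_levelData H I U hbasis V (fun i g v => g • v) comp (fun i g => g • c i)
    (fun i a b => mul_smul a b (c i)) (fun i => by simpa using base i) (fun i g hg hle => inc i g hg hle) blk stab

/-! ### v2 (append-only): the stabiliser input in its PROFINITE form (audit note of abc-iut-L6-t19 on p416078) -/

/-- **IUTchI:Cor2.3(ii)** (kurims p.47; used at [IUTchII] p.71 l.1–3) Topological glue: an element of the CLOSURE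
of a subgroup `K` lies in `K · U` for every open subgroup `U` (the open set `x · U` meets `K`).  This is what turns
the model-level stabiliser `Stab_{Δ^±_v}(□̃_i) ⊆ Δ̂^±_{v□} · U_i` (with the PROFINITE `Δ̂^±_{v□} =` closure of
`Δ^±_{v□}`, [IUTchI] Cor 2.3 (ii)) into the tempered form `⊆ Δ^±_{v□} · U_i` consumed by `hlevel_of_levelData`.
PROVED. [claim: Mochizuki2012, status: disputed] -/
theorem exists_mem_inv_mul_mem_of_mem_closure {G : Type*} [Group G] [TopologicalSpace G] [ContinuousMul G]
    (K U : Subgroup G) (hU : IsOpen (U : Set G)) {x : G} (hx : x ∈ closure (K : Set G)) :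
    ∃ k ∈ K, k⁻¹ * x ∈ U := by
  -- the open neighbourhood `{y | y⁻¹ * x ∈ U}` of `x` (it contains `x` since `1 ∈ U`) meets `K`
  have hopen : IsOpen {y : G | x⁻¹ * y ∈ U} := hU.preimage (continuous_const.mul continuous_id)
  have hxmem : x ∈ {y : G | x⁻¹ * y ∈ U} := by simp [U.one_mem]
  obtain ⟨k, hkU, hkK⟩ := mem_closure_iff.mp hx _ hopen hxmem
  refine ⟨k, hkK, ?_⟩
  have : (x⁻¹ * k)⁻¹ ∈ U := U.inv_mem hkU
  simpa [mul_inv_rev] using this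

/-- **IUTchII:Cor2.4(i)** (kurims p.71 l.1–3, ONE finite level, profinite stabiliser) `hlevel_of_levelData` with the
stabiliser input in the form the genuine tower supplies it: `stabCl` — an element of `Δ^±_v` mapping `□̃_i` into itself
lies in `closure(Δ^±_{v□}) · U_i` (decomposition group of `□̃_i` read in the PROFINITE completion, i.e. via
`Δ̂^±_{v□}`, [CombGC] Prop 1.2 (ii) / [IUTchI] Cor 2.3 (ii)) — together with the OPENNESS of the level `U_i`.
PROVED (`exists_mem_inv_mul_mem_of_mem_closure`). [claim: Mochizuki2012, status: disputed] -/
theorem hlevel_of_levelData_closure (H : Subgroup P) (I : Subgroup W.Corhat) (U : Subgroup W.Corhat)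
    (hU : IsOpen (U : Set W.Corhat))
    {V : Type*} (sm : W.Corhat → V → V) (comp : Set V) (cuspVtx : W.Corhat → V)
    (cuspVtx_mul : ∀ a b : W.Corhat, cuspVtx (a * b) = sm a (cuspVtx b))
    (base : cuspVtx 1 ∈ comp)
    (inc : ∀ g : W.Corhat, g ∈ W.piPM ⊓ W.aug.ker →
      I.map (MulAut.conj g).toMonoidHom ≤ W.pmBox H → cuspVtx g ∈ comp)
    (blk : ∀ g : W.Corhat, g ∈ W.piPM ⊓ W.aug.ker →
      (∃ v ∈ comp, sm g v ∈ comp) → ∀ v ∈ comp, sm g v ∈ comp)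
    (stabCl : ∀ g : W.Corhat, g ∈ W.piPM ⊓ W.aug.ker →
      (∀ v ∈ comp, sm g v ∈ comp) → ∃ k ∈ closure (W.deltaPmBox H : Set W.Corhat), k⁻¹ * g ∈ U) :
    ∀ γ' : W.Corhat, γ' ∈ W.piPM ⊓ W.aug.ker →
      I.map (MulAut.conj γ').toMonoidHom ≤ W.pmBox H → ∃ k ∈ W.deltaPmBox H, k⁻¹ * γ' ∈ U := by
  refine PlusMinusTower.hlevel_of_levelData W H I U sm comp cuspVtx cuspVtx_mul base inc blk ?_
  intro g hg hstab
  obtain ⟨k₀, hk₀, hk₀g⟩ := stabCl g hg hstab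
  obtain ⟨k, hk, hkk₀⟩ := exists_mem_inv_mul_mem_of_mem_closure (W.deltaPmBox H) U hU hk₀
  refine ⟨k, hk, ?_⟩
  have : k⁻¹ * k₀ * (k₀⁻¹ * g) ∈ U := U.mul_mem hkk₀ hk₀g
  simpa [mul_assoc] using this

end PlusMinusTower

end Literature.IUT.HodgeArakelov
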